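import Mathlib
import Summits.NavierStokesRegularity.NavierStokesRegularity.Theorems.SubOnsagerCeilingSideBranchWitness
import Summits.NavierStokesRegularity.NavierStokesRegularity.Theorems.OrthantWakeOrthantTableStructure
import Summits.NavierStokesRegularity.NavierStokesRegularity.Theorems.SubOnsagerCeilingKPSideBranchClassWitness
import HarnessLib

/-!
# The halved-pump side-branch class rung (`b ∈ [1.78, 2]`) is NOT VACUOUS: an admissible table of `E₂(80)`
(helper file for crux stmt-NavierStokesRegularity-27057 `SubOnsagerCeiling.ForwardTailCeilingKP`, `--supports … --as helper`;
companion of `SubOnsagerCeilingKPSideBranchClassTenCeiling`; sibling of `SubOnsagerCeilingKPSideBranchClassWitness`)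

The rung `sideClass_fwdCeilingKP_ten` is stated for KP networks proper whose couplings are the chain `0 → 0` (weight
`c₀`), the pump `0 → 1` (weight `P`) and the exit feed `1 → 2` (weight `f`) with `13P² < f²κ⁴`,
`10Pκb^{5/2} ≤ c₀b^{2θ}`, `Pb^{5/2} ≤ c₀b^{2θ}`. This file shows that such tables EXIST inside the crux's hypotheses on
the whole range `ε₀ ∈ [39/50, 1]`: any table with the closed forms below (chain weight `1`, pump weight `1/40`, exit
weight `1`) is symmetric (4.2), cancelling (4.3), `80`-comparable, ORTHANT and has diagonal feeds (`tinySide_comparable`, `tinySide_hP`, the sibling's `weakSide_diagonal` / `weakSide_hw`, and the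
clauses proved inline in `sideClassTen_nonempty`), and
the weights `c₀ = 1, P = 1/40, f = 1, κ = 1` satisfy the three smallness conditions at every `ε₀ ∈ [39/50, 1]`
(`tinySide_weights`: `b^{149/100} ≤ 2^{149/100} ≤ 4`); `sideClassTen_nonempty` packages the existence statement.
MODEL lattice algebra; nothing here bears on Navier–Stokes regularity.
-/

noncomputable section

-- the sub-problem namespace `NavierStokesRegularity.NavierStokesRegularity` is the tree's layout (D-0017)
set_option linter.dupNamespace false

namespace Summit.NavierStokesRegularity.NavierStokesRegularity.Theorems

open Literature.Analysis.FluidPDE.TaoCascade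
open Summit.NavierStokesRegularity.NavierStokesRegularity.Theorems.SubOnsagerCeiling

section TinySide

variable {α : Fin 4 → Fin 4 → Fin 4 → ℤ × ℤ × ℤ → ℝ}
  (hfeed : ∀ i₁ i₂ i₃ : Fin 4, α i₁ i₂ i₃ ((0 : ℤ), (0 : ℤ), (1 : ℤ)) =
    (if i₁ = 0 ∧ i₂ = 0 ∧ i₃ = 0 then (1 : ℝ) else 0) + (if i₁ = 1 ∧ i₂ = 1 ∧ i₃ = 2 then 1 else 0))
  (hup1 : ∀ i₁ i₂ i₃ : Fin 4, α i₁ i₂ i₃ ((1 : ℤ), (0 : ℤ), (0 : ℤ)) =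
    (if i₁ = 0 ∧ i₂ = 0 ∧ i₃ = 0 then (-(1 / 2) : ℝ) else 0) + (if i₁ = 2 ∧ i₂ = 1 ∧ i₃ = 1 then -(1 / 2) else 0))
  (hup2 : ∀ i₁ i₂ i₃ : Fin 4, α i₁ i₂ i₃ ((0 : ℤ), (1 : ℤ), (0 : ℤ)) =
    (if i₁ = 0 ∧ i₂ = 0 ∧ i₃ = 0 then (-(1 / 2) : ℝ) else 0) + (if i₁ = 1 ∧ i₂ = 2 ∧ i₃ = 1 then -(1 / 2) else 0))
  (hin : ∀ i₁ i₂ i₃ : Fin 4, α i₁ i₂ i₃ ((0 : ℤ), (0 : ℤ), (0 : ℤ)) =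
    (if i₁ = 0 ∧ i₂ = 0 ∧ i₃ = 1 then (1 / 40 : ℝ) else 0) +
      (if ((i₁ = 0 ∧ i₂ = 1) ∨ (i₁ = 1 ∧ i₂ = 0)) ∧ i₃ = 0 then -(1 / 80) else 0))
include hfeed hup1 hup2 hin

/-- `80`-comparability: moduli `≤ 1`, non-zero moduli `≥ 1/80`. [this file] -/
theorem tinySide_comparable : IsComparableCoeff 80 α := by
  intro i₁ i₂ i₃ μ hμ
  rw [mem_shiftSet_iff] at hμ
  rcases hμ with rfl | rfl | rfl | rfl <;>
    simp only [hin, hfeed, hup1, hup2] <;>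
    fin_cases i₁ <;> fin_cases i₂ <;> fin_cases i₃ <;> simp <;> norm_num

omit hfeed hup1 hup2 in
/-- The class hypothesis `hP` with `P = 1/40`. [this file] -/
theorem tinySide_hP : ∀ a c : Fin 4, a ≠ c → α a a c (0, 0, 0) = if a = 0 ∧ c = 1 then (1 / 40 : ℝ) else 0 := by
  intro a c hac
  rw [hin]
  fin_cases a <;> fin_cases c <;> simp at hac ⊢

end TinySide

/-- **The weights `c₀ = 1, P = 1/40, f = 1, κ = 1` are admissible for the halved-pump class at every
`ε₀ ∈ [39/50, 1]`.** [this file] -/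
theorem tinySide_weights {ε₀ : ℝ} (hε : 39 / 50 ≤ ε₀) (hε1 : ε₀ ≤ 1) :
    13 * (1 / 40 : ℝ) ^ 2 < (1 : ℝ) ^ 2 * (1 : ℝ) ^ 4 ∧
      10 * (1 / 40 : ℝ) * 1 * (1 + ε₀) ^ ((5 : ℝ) / 2) ≤ 1 * ((1 + ε₀) ^ ((101 : ℝ) / 200)) ^ 2 ∧
      (1 / 40 : ℝ) * (1 + ε₀) ^ ((5 : ℝ) / 2) ≤ 1 * ((1 + ε₀) ^ ((101 : ℝ) / 200)) ^ 2 := by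
  have hb0 : (0 : ℝ) < 1 + ε₀ := by linarith
  have hb1 : (1 : ℝ) ≤ 1 + ε₀ := by linarith
  have hb2 : 1 + ε₀ ≤ 2 := by linarith
  -- `b^{5/2} = b^{149/100} · (b^{101/200})²` and `b^{149/100} ≤ 2^{149/100} ≤ 4`
  have hsq : ((1 + ε₀) ^ ((101 : ℝ) / 200)) ^ 2 = (1 + ε₀) ^ ((101 : ℝ) / 100) := by
    rw [← Real.rpow_natCast, ← Real.rpow_mul hb0.le]; norm_num
  have hsplit : (1 + ε₀) ^ ((5 : ℝ) / 2) = (1 + ε₀) ^ ((149 : ℝ) / 100) * (1 + ε₀) ^ ((101 : ℝ) / 100) := by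
    rw [← Real.rpow_add hb0]; norm_num
  have h149 : (1 + ε₀) ^ ((149 : ℝ) / 100) ≤ 4 := by
    calc (1 + ε₀) ^ ((149 : ℝ) / 100) ≤ (2 : ℝ) ^ ((149 : ℝ) / 100) :=
          Real.rpow_le_rpow hb0.le hb2 (by norm_num)
      _ ≤ (2 : ℝ) ^ ((2 : ℕ) : ℝ) := Real.rpow_le_rpow_of_exponent_le (by norm_num) (by norm_num)
      _ = 4 := by rw [Real.rpow_natCast]; norm_num
  have hpos : 0 < (1 + ε₀) ^ ((101 : ℝ) / 100) := Real.rpow_pos_of_pos hb0 _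
  refine ⟨by norm_num, ?_, ?_⟩
  · rw [hsq, hsplit]
    nlinarith [mul_le_mul_of_nonneg_right h149 hpos.le]
  · rw [hsq, hsplit]
    nlinarith [mul_le_mul_of_nonneg_right h149 hpos.le]

/-- **THE SIDE-BRANCH CLASS IS NON-EMPTY INSIDE THE CRUX'S HYPOTHESES**: there is a table of `E₂(80)` that is
orthant, has diagonal feeds, and has exactly the couplings chain `1`, pump `1/40`, exit feed `1` (no
differential triads) — admissible weights for `sideClass_fwdCeilingKP_ten` at every `ε₀ ∈ [39/50, 1]` with `κ = 1`
(`tinySide_weights`). [this file] -/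
theorem sideClassTen_nonempty : ∃ α : Fin 4 → Fin 4 → Fin 4 → ℤ × ℤ × ℤ → ℝ,
    Literature.Analysis.FluidPDE.TaoCascade.InTableClass 80 α ∧
    (∀ (Y : Fin 4 → ℤ → ℝ → ℝ) (τ : ℝ), (∀ (j : Fin 4) (k : ℤ), 1 ≤ k → 0 ≤ Y j k τ) →
      ∀ δ : ℝ, 0 < δ → ∀ (i : Fin 4) (n : ℤ), 1 ≤ n → Y i n τ = 0 → 0 ≤ quadTerm δ α Y i n τ) ∧
    (∀ a b i : Fin 4, a ≠ b → α a b i (0, 0, 1) = 0) ∧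
    (∀ a c : Fin 4, α a a c (0, 0, 1) = (if a = 0 ∧ c = 0 then (1 : ℝ) else 0) + (if a = 1 ∧ c = 2 then (1 : ℝ) else 0)) ∧
    (∀ a c : Fin 4, a ≠ c → α a a c (0, 0, 0) = if a = 0 ∧ c = 1 then (1 / 40 : ℝ) else 0) ∧
    (∀ a b c : Fin 4, a ≠ b → a ≠ c → b ≠ c → α a b c (0, 0, 0) = 0) := by
  set α : Fin 4 → Fin 4 → Fin 4 → ℤ × ℤ × ℤ → ℝ := fun i₁ i₂ i₃ μ =>
    dyadicTable i₁ i₂ i₃ μ +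
      (if μ = ((0 : ℤ), (0 : ℤ), (0 : ℤ)) then (1 / 8 : ℝ) else 5) * (sideBranchTable i₁ i₂ i₃ μ - dyadicTable i₁ i₂ i₃ μ)
    with hα
  have hdy : ∀ i₁ i₂ i₃ : Fin 4, ∀ μ : ℤ × ℤ × ℤ, dyadicTable i₁ i₂ i₃ μ =
      if i₁ = 0 ∧ i₂ = 0 ∧ i₃ = 0 then
        (if μ = ((0 : ℤ), (0 : ℤ), (1 : ℤ)) then (1 : ℝ)
          else if μ = ((1 : ℤ), (0 : ℤ), (0 : ℤ)) ∨ μ = ((0 : ℤ), (1 : ℤ), (0 : ℤ)) then -(1 / 2) else 0)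
      else 0 := fun _ _ _ _ => rfl
  have hfeed : ∀ i₁ i₂ i₃ : Fin 4, α i₁ i₂ i₃ ((0 : ℤ), (0 : ℤ), (1 : ℤ)) =
      (if i₁ = 0 ∧ i₂ = 0 ∧ i₃ = 0 then (1 : ℝ) else 0) + (if i₁ = 1 ∧ i₂ = 1 ∧ i₃ = 2 then 1 else 0) := by
    intro i₁ i₂ i₃
    simp only [hα, sideBranchTable_feed, hdy]
    by_cases h0 : i₁ = 0 ∧ i₂ = 0 ∧ i₃ = 0 <;> by_cases h1 : i₁ = 1 ∧ i₂ = 1 ∧ i₃ = 2 <;> norm_num [h0, h1]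
  have hup1 : ∀ i₁ i₂ i₃ : Fin 4, α i₁ i₂ i₃ ((1 : ℤ), (0 : ℤ), (0 : ℤ)) =
      (if i₁ = 0 ∧ i₂ = 0 ∧ i₃ = 0 then (-(1 / 2) : ℝ) else 0) + (if i₁ = 2 ∧ i₂ = 1 ∧ i₃ = 1 then -(1 / 2) else 0) := by
    intro i₁ i₂ i₃
    simp only [hα, sideBranchTable_up1, hdy]
    by_cases h0 : i₁ = 0 ∧ i₂ = 0 ∧ i₃ = 0 <;> by_cases h1 : i₁ = 2 ∧ i₂ = 1 ∧ i₃ = 1 <;> norm_num [h0, h1]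
  have hup2 : ∀ i₁ i₂ i₃ : Fin 4, α i₁ i₂ i₃ ((0 : ℤ), (1 : ℤ), (0 : ℤ)) =
      (if i₁ = 0 ∧ i₂ = 0 ∧ i₃ = 0 then (-(1 / 2) : ℝ) else 0) + (if i₁ = 1 ∧ i₂ = 2 ∧ i₃ = 1 then -(1 / 2) else 0) := by
    intro i₁ i₂ i₃
    simp only [hα, sideBranchTable_up2, hdy]
    by_cases h0 : i₁ = 0 ∧ i₂ = 0 ∧ i₃ = 0 <;> by_cases h1 : i₁ = 1 ∧ i₂ = 2 ∧ i₃ = 1 <;> norm_num [h0, h1]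
  have hin : ∀ i₁ i₂ i₃ : Fin 4, α i₁ i₂ i₃ ((0 : ℤ), (0 : ℤ), (0 : ℤ)) =
      (if i₁ = 0 ∧ i₂ = 0 ∧ i₃ = 1 then (1 / 40 : ℝ) else 0) +
        (if ((i₁ = 0 ∧ i₂ = 1) ∨ (i₁ = 1 ∧ i₂ = 0)) ∧ i₃ = 0 then -(1 / 80) else 0) := by
    intro i₁ i₂ i₃
    simp only [hα, sideBranchTable_inshell, hdy]
    by_cases h0 : i₁ = 0 ∧ i₂ = 0 ∧ i₃ = 1 <;>
      by_cases h1 : ((i₁ = 0 ∧ i₂ = 1) ∨ (i₁ = 1 ∧ i₂ = 0)) ∧ i₃ = 0 <;> norm_num [h0, h1]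
  -- symmetry (4.2), cancellation (4.3), the orthant clause and «no triads» for this table
  have hsym : IsSymmetricCoeff α := by
    intro i₁ i₂ i₃ μ₁ μ₂ μ₃ hμ
    rw [mem_shiftSet_iff] at hμ
    simp only [Prod.mk.injEq] at hμ
    rcases hμ with ⟨rfl, rfl, rfl⟩ | ⟨rfl, rfl, rfl⟩ | ⟨rfl, rfl, rfl⟩ | ⟨rfl, rfl, rfl⟩
    · simp only [hin]
      fin_cases i₁ <;> fin_cases i₂ <;> fin_cases i₃ <;> simp
    · simp only [hup1, hup2]
      fin_cases i₁ <;> fin_cases i₂ <;> fin_cases i₃ <;> simp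
    · simp only [hup1, hup2]
      fin_cases i₁ <;> fin_cases i₂ <;> fin_cases i₃ <;> simp
    · simp only [hfeed]
      fin_cases i₁ <;> fin_cases i₂ <;> fin_cases i₃ <;> simp
  have hcan : IsCancellingCoeff α := by
    intro i₁ i₂ i₃ μ₁ μ₂ μ₃ hμ
    rw [mem_shiftSet_iff] at hμ
    simp only [Prod.mk.injEq] at hμ
    rcases hμ with ⟨rfl, rfl, rfl⟩ | ⟨rfl, rfl, rfl⟩ | ⟨rfl, rfl, rfl⟩ | ⟨rfl, rfl, rfl⟩ <;>
      simp only [hin, hfeed, hup1, hup2] <;>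
      fin_cases i₁ <;> fin_cases i₂ <;> fin_cases i₃ <;> simp <;> norm_num
  have horth : ∀ (Y : Fin 4 → ℤ → ℝ → ℝ) (τ : ℝ), (∀ (j : Fin 4) (k : ℤ), 1 ≤ k → 0 ≤ Y j k τ) →
      ∀ δ : ℝ, 0 < δ → ∀ (i : Fin 4) (n : ℤ), 1 ≤ n → Y i n τ = 0 → 0 ≤ quadTerm δ α Y i n τ := by
    rw [orthant_iff_coefficients]
    refine ⟨?_, ?_, ?_⟩
    · intro i w
      simp only [hfeed, Fin.sum_univ_four]
      fin_cases i <;> simp <;> nlinarith [mul_self_nonneg (w 0), mul_self_nonneg (w 1)]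
    · intro i a b hbi
      simp only [hup1, hup2]
      fin_cases i <;> fin_cases a <;> fin_cases b <;> simp at hbi ⊢
    · intro i y hy hyi
      simp only [hin, Fin.sum_univ_four]
      fin_cases i <;> simp at hyi ⊢ <;> nlinarith [mul_self_nonneg (y 0), hy 0, hy 1, hyi]
  have hCz : ∀ a b c : Fin 4, a ≠ b → a ≠ c → b ≠ c → α a b c (0, 0, 0) = 0 := by
    intro a b c hab hac hbc
    rw [hin]
    fin_cases a <;> fin_cases b <;> fin_cases c <;> simp at hab hac hbc ⊢
  exact ⟨α, ⟨hsym, hcan, tinySide_comparable hfeed hup1 hup2 hin⟩, horth,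
    weakSide_diagonal hfeed, weakSide_hw hfeed, tinySide_hP hin, hCz⟩

end Summit.NavierStokesRegularity.NavierStokesRegularity.Theorems

end
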